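import Literature.NumberTheory.LFunctions.LevinsonMethodConditional
import HarnessLib

/-!
# Dirichlet-polynomial mollifiers in Levinson's method, and the reduction of `przz_bound`

Topic `Literature/NumberTheory/LFunctions`. Everything here is PROVED; there are no definitions
and no named facts.

`Literature.NumberTheory.LFunctions.levinson_criticalLineProportion_ge` (Levinson's method in
Conrey's form, conditional on the mollified mean square) asks three things of the mollifier family
`ψ_T`: entire, of polynomial growth in `0 ≤ Re z`, `0 ≤ Im z ≤ 3T`, and `→ 1` on far-right
half-integer lines. Every family of Dirichlet polynomials
`ψ_T(s) = Σ_{n ≤ N_T} a_T(n) n^{−s}` with `a_T(1) = 1`, `|a_T(n)| ≤ A n^κ` and `1 ≤ N_T ≤ T^θ`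
(Levinson's `μ(n) n^{σ₀−½} P(log(y/n)/log y)`, Conrey's, Feng's and PRZZ's mollifiers are all of this
shape) satisfies them (`dirichletPolynomial_mollifier_conditions`). Consequently
(`przz_bound_of_mollified_meanSquare`) the named fact
`Literature.NumberTheory.LFunctions.przz_bound : 5/12 < κ` follows from exactly two further inputs
about such data `(Q, R, a, N)`:

* the mollified mean square `∫_T^{2T} |ψ_T V_T(a_T + it)|² dt ≤ (c + ε) T` eventually, for every
  `ε > 0` (`V_T = conreyV Q (log T)`, `a_T = ½ − R/log T`) — PRZZ 2020, Theorem 1.3 with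
  Theorems 4.1 and 7.1, for their `Q`, `ψ = ψ₁ + ψ₂ + ψ₃`, `θ = 4/7 − ε`, `R = 1.3036`.
  CAVEAT for whoever supplies this input: PRZZ state Theorem 1.3 for `V = Q(−L⁻¹d/ds)ζ`
  ((1.9)), whereas `conreyV` is Conrey's exact-identity variant
  `Q(−L⁻¹δ)𝓡 + χ · Q(1 − L⁻¹δ)K` built from Siegel's integral formula (Conrey 1983, §4 (1)–(2);
  the two agree to leading order since `χ'/χ = −log(t/2π) + O(1/t) ≈ −L`, Conrey 1983 Lemma 4),
  so the mean value theorem has to be run for this `V` (same main term `c(P, Q, R)`);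
* the numerical inequality `5/12 < 1 − (log c)/R` (PRZZ 2020, §8: `1 − (log c)/R ≥ 0.417293962`).

## References

* K. Pratt, N. Robles, A. Zaharescu, D. Zeindler, *More than five-twelfths of the zeros of `ζ`
  are on the critical line*, Res. Math. Sci. 7 (2020), Thm 1.3, §8. [PrattRoblesZaharescuZeindler2020]
* J. B. Conrey, J. Number Theory 16 (1983), 49–74, §4. [Conrey1983]
* N. Levinson, Adv. Math. 13 (1974), 383–436.
-/

noncomputable section

open Complex Polynomial Set Filter Topology Metric MeasureTheory intervalIntegral Asymptotics
open scoped Real ComplexConjugate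

namespace Literature.NumberTheory.LFunctions

open Literature.Analysis.Complex SiegelIntegral

/-- `‖n^{-s}‖ ≤ 1` for `n ≥ 1` and `Re s ≥ 0`. [folklore] -/
theorem norm_natCast_cpow_neg_le_one {n : ℕ} (hn : 1 ≤ n) {s : ℂ} (hs : 0 ≤ s.re) :
    ‖(n : ℂ) ^ (-s)‖ ≤ 1 := by
  rw [Complex.norm_natCast_cpow_of_pos (by omega), neg_re]
  exact Real.rpow_le_one_of_one_le_of_nonpos (by exact_mod_cast hn) (by linarith)

/-- **Dirichlet-polynomial mollifier families are admissible.** Let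
`ψ_T(s) = Σ_{1 ≤ n ≤ N_T} a_T(n) n^{−s}` with `a_T(1) = 1`, `‖a_T(n)‖ ≤ A n^κ` (`A, κ ≥ 0`) and,
for all large `T`, `1 ≤ N_T ≤ T^θ`. Then every `ψ_T` is entire; `‖ψ_T(z)‖ ≤ T^{θ(κ+1)+1}`
for `Re z ≥ 0` and all large `T`; and for every `ε > 0` there is `m₀` with
`‖ψ_T(m + ½ + it) − 1‖ ≤ ε` for all `m ≥ m₀`, all large `T` and all real `t`
(`Σ_{n≥2} A n^{κ−m−½} ≤ A/(m − κ − ½)`). [folklore] -/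
theorem dirichletPolynomial_mollifier_conditions (a : ℝ → ℕ → ℂ) (N : ℝ → ℕ) {A κ θ : ℝ}
    (hA : 0 ≤ A) (hκ : 0 ≤ κ)
    (hN : ∀ᶠ T : ℝ in atTop, 1 ≤ N T ∧ (N T : ℝ) ≤ T ^ θ)
    (ha : ∀ T : ℝ, ∀ n : ℕ, ‖a T n‖ ≤ A * (n : ℝ) ^ κ) (ha1 : ∀ T : ℝ, a T 1 = 1)
    (ψ : ℝ → ℂ → ℂ) (hψ : ∀ T : ℝ, ∀ s : ℂ, ψ T s = ∑ n ∈ Finset.Icc 1 (N T), a T n * (n : ℂ) ^ (-s)) :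
    (∀ T : ℝ, Differentiable ℂ (ψ T)) ∧
    (∃ k : ℝ, ∀ᶠ T : ℝ in atTop, ∀ z : ℂ, 0 ≤ z.re → 0 ≤ z.im → z.im ≤ 3 * T → ‖ψ T z‖ ≤ T ^ k) ∧
    (∀ ε > 0, ∃ m₀ : ℕ, ∀ m : ℕ, m₀ ≤ m → ∀ᶠ T : ℝ in atTop, ∀ t ∈ Icc T (2 * T),
      ‖ψ T ((((m : ℝ) + 1 / 2 : ℝ) : ℂ) + t * I) - 1‖ ≤ ε) := by
  have hfun : ∀ T : ℝ, ψ T = fun s ↦ ∑ n ∈ Finset.Icc 1 (N T), a T n * (n : ℂ) ^ (-s) :=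
    fun T ↦ funext (hψ T)
  refine ⟨fun T ↦ ?_, ?_, ?_⟩
  · -- entire
    rw [hfun T]
    refine Differentiable.fun_sum fun n hn ↦ ?_
    have hn1 : 1 ≤ n := (Finset.mem_Icc.1 hn).1
    refine (Differentiable.const_cpow differentiable_neg (Or.inl ?_)).const_mul _
    exact_mod_cast (show n ≠ 0 by omega)
  · -- polynomial growth: `‖ψ_T(z)‖ ≤ Σ A n^κ ≤ N · A N^κ ≤ A T^{θ(κ+1)} ≤ T^{θ(κ+1)+1}` for `T ≥ A, 1`
    refine ⟨θ * (κ + 1) + 1, ?_⟩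
    filter_upwards [hN, eventually_ge_atTop (max A 1)] with T hNT hTA z hz _ _
    obtain ⟨hN1, hNθ⟩ := hNT
    have hT1 : 1 ≤ T := le_trans (le_max_right _ _) hTA
    have hTA' : A ≤ T := le_trans (le_max_left _ _) hTA
    have hNpos : (1 : ℝ) ≤ N T := by exact_mod_cast hN1
    rw [hψ T z]
    calc ‖∑ n ∈ Finset.Icc 1 (N T), a T n * (n : ℂ) ^ (-z)‖
        ≤ ∑ n ∈ Finset.Icc 1 (N T), ‖a T n * (n : ℂ) ^ (-z)‖ := norm_sum_le _ _
      _ ≤ ∑ n ∈ Finset.Icc 1 (N T), A * (N T : ℝ) ^ κ := by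
          refine Finset.sum_le_sum fun n hn ↦ ?_
          have hn1 : 1 ≤ n := (Finset.mem_Icc.1 hn).1
          have hnN : (n : ℝ) ≤ N T := by exact_mod_cast (Finset.mem_Icc.1 hn).2
          rw [norm_mul]
          calc ‖a T n‖ * ‖(n : ℂ) ^ (-z)‖ ≤ A * (n : ℝ) ^ κ * 1 :=
                mul_le_mul (ha T n) (norm_natCast_cpow_neg_le_one hn1 hz) (norm_nonneg _) (by positivity)
            _ ≤ A * (N T : ℝ) ^ κ := by
                rw [mul_one]
                exact mul_le_mul_of_nonneg_left (Real.rpow_le_rpow (by positivity) hnN hκ) hA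
      _ = (N T : ℝ) * (A * (N T : ℝ) ^ κ) := by simp
      _ ≤ T ^ θ * (A * (T ^ θ) ^ κ) := by
          have h1 : (N T : ℝ) ^ κ ≤ (T ^ θ) ^ κ := Real.rpow_le_rpow (by positivity) hNθ hκ
          have h2 : 0 ≤ A * (N T : ℝ) ^ κ := by positivity
          calc (N T : ℝ) * (A * (N T : ℝ) ^ κ) ≤ T ^ θ * (A * (N T : ℝ) ^ κ) :=
                mul_le_mul_of_nonneg_right hNθ h2
            _ ≤ T ^ θ * (A * (T ^ θ) ^ κ) := by
                refine mul_le_mul_of_nonneg_left (mul_le_mul_of_nonneg_left h1 hA) (by positivity)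
      _ = A * T ^ (θ * (κ + 1)) := by
          rw [← Real.rpow_mul (by linarith), show θ * (κ + 1) = θ + θ * κ by ring,
            Real.rpow_add (by linarith)]
          ring
      _ ≤ T * T ^ (θ * (κ + 1)) := mul_le_mul_of_nonneg_right hTA' (by positivity)
      _ = T ^ (θ * (κ + 1) + 1) := by
          rw [add_comm (θ * (κ + 1)) 1, Real.rpow_add (by linarith), Real.rpow_one]
  · -- `→ 1` on the line `σ = m + ½`
    intro ε hε
    refine ⟨⌈A / ε + κ + 2⌉₊, fun m hm ↦ ?_⟩
    have hm' : A / ε + κ + 2 ≤ m := le_trans (Nat.le_ceil _) (by exact_mod_cast hm)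
    filter_upwards [hN] with T hNT t _
    obtain ⟨hN1, -⟩ := hNT
    set b : ℝ := (m : ℝ) + 1 / 2 with hb
    set s : ℂ := ((b : ℝ) : ℂ) + t * I with hs
    have hsre : s.re = b := by simp [hs]
    -- split off `n = 1`
    have hsplit : ψ T s - 1 = ∑ n ∈ Finset.Icc 2 (N T), a T n * (n : ℂ) ^ (-s) := by
      rw [hψ T s]
      have hI : Finset.Icc 2 (N T) = Finset.Ioc 1 (N T) :=
        show Finset.Icc (1 + 1) (N T) = _ from Finset.Icc_add_one_left_eq_Ioc 1 (N T)
      rw [hI, Finset.Icc_eq_cons_Ioc hN1, Finset.sum_cons, ha1]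
      simp
    rw [hsplit]
    -- `σ' = b - κ > 1`
    have hAε : 0 ≤ A / ε := by positivity
    have hσ : 1 < b - κ := by rw [hb]; linarith
    calc ‖∑ n ∈ Finset.Icc 2 (N T), a T n * (n : ℂ) ^ (-s)‖
        ≤ ∑ n ∈ Finset.Icc 2 (N T), ‖a T n * (n : ℂ) ^ (-s)‖ := norm_sum_le _ _
      _ ≤ ∑ n ∈ Finset.Icc 2 (N T), A * (n : ℝ) ^ (-(b - κ)) := by
          refine Finset.sum_le_sum fun n hn ↦ ?_
          have hn2 : 2 ≤ n := (Finset.mem_Icc.1 hn).1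
          have hn0 : (0 : ℝ) < n := by exact_mod_cast (show 0 < n by omega)
          rw [norm_mul, Complex.norm_natCast_cpow_of_pos (by omega), neg_re, hsre]
          calc ‖a T n‖ * (n : ℝ) ^ (-b) ≤ A * (n : ℝ) ^ κ * (n : ℝ) ^ (-b) :=
                mul_le_mul_of_nonneg_right (ha T n) (by positivity)
            _ = A * (n : ℝ) ^ (-(b - κ)) := by
                rw [mul_assoc, ← Real.rpow_add hn0]; congr 2; ring
      _ = A * ∑ n ∈ Finset.Icc 2 (N T), (n : ℝ) ^ (-(b - κ)) := by rw [Finset.mul_sum]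
      _ ≤ A * (1 / (b - κ - 1)) :=
          mul_le_mul_of_nonneg_left (sum_Icc_two_rpow_neg_le hσ (N T)) hA
      _ ≤ ε := by
          -- `b - κ - 1 = m - κ - 1/2 ≥ A/ε + 3/2`, so `A/(b-κ-1) ≤ ε`
          have h1 : A / ε + 3 / 2 ≤ b - κ - 1 := by rw [hb]; linarith
          have h2 : 0 < b - κ - 1 := by linarith
          rw [mul_one_div, div_le_iff₀ h2]
          have h3 : A ≤ ε * (A / ε + 3 / 2) := by
            rw [mul_add, mul_div_cancel₀ _ hε.ne']; linarith
          nlinarith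

/-- **`przz_bound` from the mollified mean square and the numerics.** Let `Q ∈ ℝ[X]` with
`Q(x) + Q(1−x) = c ≠ 0`, `Q(0) = 1`; `R > 0`; a Dirichlet-polynomial mollifier family
`ψ_T(s) = Σ_{n ≤ N_T} a_T(n) n^{−s}` (`a_T(1) = 1`, `|a_T(n)| ≤ A n^κ`, `1 ≤ N_T ≤ T^θ` eventually);
and a constant `c_ms ≥ 1` such that (PRZZ 2020, Thm 1.3 with Thms 4.1, 7.1 for their data) for every
`ε > 0`, eventually `∫_T^{2T} |ψ_T(a_T+it) V_T(a_T+it)|² dt ≤ (c_ms + ε)T` (`V_T = conreyV Q (log T)`,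
`a_T = ½ − R/log T`), and (PRZZ 2020, §8) `5/12 < 1 − (log c_ms)/R`. Then
`Literature.NumberTheory.LFunctions.przz_bound` holds. [cite: PrattRoblesZaharescuZeindler2020, Thm 1.2, Thm 1.3, §8] -/
theorem przz_bound_of_mollified_meanSquare {Q : ℝ[X]} {c : ℝ} (hQ : Q + Q.comp (1 - X) = C c)
    (hc : c ≠ 0) (hQ1 : Q.coeff 0 = 1) {R : ℝ} (hR : 0 < R)
    (a : ℝ → ℕ → ℂ) (N : ℝ → ℕ) {A κ θ : ℝ} (hA : 0 ≤ A) (hκ : 0 ≤ κ)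
    (hN : ∀ᶠ T : ℝ in atTop, 1 ≤ N T ∧ (N T : ℝ) ≤ T ^ θ)
    (ha : ∀ T : ℝ, ∀ n : ℕ, ‖a T n‖ ≤ A * (n : ℝ) ^ κ) (ha1 : ∀ T : ℝ, a T 1 = 1)
    {cms : ℝ} (hcms : 1 ≤ cms)
    (hms : ∀ ε > 0, ∀ᶠ T : ℝ in atTop,
      ∫ t in T..2 * T, ‖(∑ n ∈ Finset.Icc 1 (N T), a T n * (n : ℂ) ^ (-((((1 / 2 - R / Real.log T : ℝ)) : ℂ) + t * I))) *
        conreyV Q (Real.log T) (((1 / 2 - R / Real.log T : ℝ) : ℂ) + t * I)‖ ^ 2 ≤ (cms + ε) * T)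
    (hnum : (5 / 12 : ℝ) < 1 - Real.log cms / R) :
    przz_bound := by
  set ψ : ℝ → ℂ → ℂ := fun T s ↦ ∑ n ∈ Finset.Icc 1 (N T), a T n * (n : ℂ) ^ (-s) with hψ
  obtain ⟨hψd, hψB, hψ1⟩ := dirichletPolynomial_mollifier_conditions a N hA hκ hN ha ha1 ψ
    (fun T s ↦ rfl)
  exact lt_of_lt_of_le hnum (levinson_criticalLineProportion_ge hQ hc hQ1 hR hcms ψ hψd hψB hψ1 hms)

end Literature.NumberTheory.LFunctions

end
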